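import Literature.AlgebraicGeometry.Resolution.Blowups
import Literature.AlgebraicGeometry.Resolution.ResolutionOfSingularities
import Mathlib.Algebra.CharP.Defs
import HarnessLib

/-!
# Non-zero ideal sheaves on a regular integral variety are finite sups of effective Cartier ideal sheaves
# (SGA 6, Exp. II, Def. 2.2.4 / Prop. 2.2.3 / 2.2.7.1 «schémas divisoriels», through the Stacks Project:
# Tag 0FXR = Def. 29.12.1, Tag 0GML = Lemma 31.17.8, Tag 0GMM = Lemma 36.36.7)

Layer `Literature/AlgebraicGeometry/Resolution` (cite item `wi-97392`, requested by the decomp-res critic, CRITIC-LEDGER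
row 39: «IdealsAreSumsOfDivisors rather as a LITERATURE FACT (SGA6) than a Theses item»; consumer: the route aside
`Summit.ResolutionOfSingularities.…Theses.Dominance.IdealsAreSumsOfDivisors` (stmt-ResolutionOfSingularities-29717),
which closes by `exact` on this fact). ONE NAMED FACT, stated VERBATIM in the route's Lean shape (tree vocabulary:
`Scheme.IsRegular`, `IsEffectiveCartier`, Mathlib `Scheme.IdealSheafData` with its complete lattice); no proof here
(net fact debt +1, declared; size estimate for a discharge: L — needs «sections of `I ⊗ L^N` extend from `X_s`»
(Stacks 01PW-type extension) and «a non-zero map `L⁻¹ → 𝒪_Y` on an integral scheme has an invertible = effective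
Cartier image», neither of which Mathlib has for invertible sheaves on schemes today).

## Sources, verbatim (held text of the Stacks Project `book.pdf`, chunks; tags are the stable locators)

* [StacksProject, Tag 0FXR = Morphisms, Def. 29.12.1, attributed there to «[BGI71, II Definition 2.2.4]» = SGA 6]
  (chunk p2446:L13–L20): «Let `X` be a scheme. Let `{L_i}_{i∈I}` be a family of invertible `𝒪_X`-modules. We say
  `{L_i}_{i∈I}` is an ample family of invertible modules on `X` if (1) `X` is quasi-compact, and (2) for every `x ∈ X`
  there exists an `i ∈ I`, an `n ≥ 1`, and `s ∈ Γ(X, L_i^{⊗n})` such that `x ∈ X_s` and `X_s` is affine.»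
* [StacksProject, Tag 0GML = Divisors, Lemma 31.17.8] (chunk p2695:L21–L30): «Let `X` be a quasi-compact, regular
  scheme with affine diagonal. Then `X` has an ample family of invertible modules.» (proof: «we may assume that `X` is
  integral … the local rings of `X` are UFDs. Hence … we can find an effective Cartier divisor `D ⊂ X` whose
  complement is `U`. Then the canonical section `s = 1_D` of `L = 𝒪_X(D)` vanishes exactly along `D` hence `U = X_s`.»)
* [StacksProject, Tag 0GMM = Derived Categories of Varieties, Lemma 36.36.7] (chunk p3162:L31–L38): «If `X` has an
  ample family of invertible modules, then `X` has the resolution property. Proof. … pairs `(L_i, s_i)` … such that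
  the set of points `U_i ⊂ X` where `s_i` is nonvanishing is affine and `X = U_1 ∪ … ∪ U_n`. Let `I_i ⊂ 𝒪_X` be the
  image of `s_i : L_i^{⊗−1} → 𝒪_X` …» — the images of non-zero sections `L^{⊗−n} → 𝒪_X` are the effective Cartier
  ideals `𝒪_X(−Z(s))`.
* Original source (not re-opened here; locators as printed in the Stacks attribution and in the requester's item):
  P. Berthelot, A. Grothendieck, L. Illusie, SGA 6, LNM 225 (1971), Exp. II, Def. 2.2.4, Prop. 2.2.3 (a family is
  ample iff every quasi-coherent `𝒪_X`-module of finite type is a quotient of a finite direct sum of modules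
  `L_i^{⊗−n}`), 2.2.7.1 (a regular — more generally locally factorial — noetherian separated scheme is divisorial);
  modern account: H. Brenner, S. Schröer, Pacific J. Math. 208 (2003) §1 (arXiv:math/0012082, chunk p0004:L49–L53:
  «we call a finite collection `L_1, …, L_r` of invertible `𝒪_X`-modules an ample family if … A scheme is called
  divisorial if it admits an ample family of invertible sheaves»).

## The statement vendored (special case used by the route: integral regular varieties over a field of characteristic p)

For `Y` integral, regular, separated and of finite type over a field `k` (so noetherian with affine diagonal) and a
non-zero quasi-coherent ideal sheaf `I` on `Y`: by 0GML `Y` carries an ample family `(L_i, s_i)` with affine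
non-vanishing loci `Y_{s_i}` covering `Y`; on each affine `Y_{s_i}` the ideal `I` is generated by finitely many
sections, which after multiplication by a power of `s_i` extend to global sections `g_{ij} : L_i^{⊗−N} → I ⊆ 𝒪_Y`
(SGA 6 II 2.2.3 (ii): `I` is a quotient of `⊕ L_i^{⊗−N}`); `Y` being integral, each non-zero `g_{ij}` is injective
with image an invertible, i.e. effective Cartier, ideal sheaf `J_{ij} = 𝒪_Y(−Z(g_{ij}))`, and `I = Σ_{ij} J_{ij}`
(the sum of subsheaves is the `⨆` of Mathlib's lattice `Scheme.IdealSheafData`). The characteristic-`p` hypothesis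
is the route's setting only (irrelevant to the statement; `-- TODO(general form): any regular noetherian scheme with
affine diagonal, any characteristic, any non-zero finite type quasi-coherent ideal`). Nothing here bears on the
summit `ResolutionOfSingularities` beyond supplying this textbook input; typed ≠ endorsed.

## References

* [StacksProject] The Stacks Project Authors, *Stacks Project*: Tags 0FXR (Def. 29.12.1), 0FXS, 0GML (Lemma 31.17.8),
  0GMM (Lemma 36.36.7), 0F8A (Lemma 36.36.8).
* SGA 6 = P. Berthelot, A. Grothendieck, L. Illusie, *Théorie des intersections et théorème de Riemann–Roch*,
  LNM 225, Springer 1971, Exp. II §2.2 (Def. 2.2.4, Prop. 2.2.3, 2.2.7.1) — no bib key yet (`ledger bib add` wanted).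
* H. Brenner, S. Schröer, *Ample families, multihomogeneous spectra, and algebraization of formal schemes*,
  Pacific J. Math. 208 (2003) 209–230, §1 — no bib key yet.
-/

namespace Literature.AlgebraicGeometry.Resolution

/-- **Non-zero ideal sheaves on a regular integral variety are finite sups of effective Cartier ideal sheaves**
(regular noetherian separated ⇒ divisorial, i.e. carries an ample family of invertible sheaves; every quasi-coherent
ideal of finite type is then a quotient of a finite direct sum of members `L^{⊗−n}` of the family, and on an integral
scheme the images of the non-zero summands `L^{⊗−n} → 𝒪_Y` are the invertible ideals `𝒪_Y(−Z(s))`). Stated in the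
shape consumed by `Dominance.IdealsAreSumsOfDivisors` (varieties over a field of characteristic `p`).
[cite: StacksProject, Tag 0GML (Lemma 31.17.8) with Tag 0FXR (Def. 29.12.1 = SGA 6 II Def. 2.2.4) and Tag 0GMM (Lemma 36.36.7)] -/
def RegularIdealSheafIsSupOfEffectiveCartier : Prop :=
  ∀ (p : ℕ), p.Prime → ∀ (k : Type) [Field k] [CharP k p] (Y : AlgebraicGeometry.Scheme.{0})
    (g : Y ⟶ AlgebraicGeometry.Spec (CommRingCat.of k)), AlgebraicGeometry.IsSeparated g →
      AlgebraicGeometry.LocallyOfFiniteType g → AlgebraicGeometry.QuasiCompact g → AlgebraicGeometry.IsIntegral Y →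
        Literature.AlgebraicGeometry.Resolution.Scheme.IsRegular Y → ∀ I : Y.IdealSheafData, I ≠ ⊥ →
          ∃ (n : ℕ) (D : Fin n → Y.IdealSheafData),
            (∀ i, Literature.AlgebraicGeometry.Resolution.IsEffectiveCartier (D i)) ∧ (⨆ i, D i) = I

/-- Unfolding lemma (same statement, binders explicit): the fact is definitionally the route's Lean shape, so the
aside closes by `exact h p hp …`. [cite: StacksProject, Tag 0GML (Lemma 31.17.8) with Tag 0FXR (Def. 29.12.1) and Tag 0GMM (Lemma 36.36.7)] -/
theorem RegularIdealSheafIsSupOfEffectiveCartier.out (h : RegularIdealSheafIsSupOfEffectiveCartier)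
    (p : ℕ) (hp : p.Prime) (k : Type) [Field k] [CharP k p] (Y : AlgebraicGeometry.Scheme.{0})
    (g : Y ⟶ AlgebraicGeometry.Spec (CommRingCat.of k)) (hs : AlgebraicGeometry.IsSeparated g)
    (hft : AlgebraicGeometry.LocallyOfFiniteType g) (hqc : AlgebraicGeometry.QuasiCompact g)
    (hint : AlgebraicGeometry.IsIntegral Y) (hreg : Scheme.IsRegular Y) (I : Y.IdealSheafData) (hI : I ≠ ⊥) :
    ∃ (n : ℕ) (D : Fin n → Y.IdealSheafData), (∀ i, IsEffectiveCartier (D i)) ∧ (⨆ i, D i) = I :=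
  h p hp k Y g hs hft hqc hint hreg I hI

end Literature.AlgebraicGeometry.Resolution
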